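import Literature.AlgebraicGeometry.Motives.AbelianVarietyPoincareSplitting
import HarnessLib

/-!
# Restricting compatible endomorphisms to the image of a homomorphism of abelian varieties

Let `f : X ⟶ Y` be a homomorphism of abelian varieties over a field `K`, with image
`im f ↪ Y` (`AbelianVariety.image`, `imageι`, `toImage` of `Motives/AbelianVarietyImage`). If
endomorphisms `a` of `X` and `b` of `Y` are compatible with `f` (`a ≫ f = f ≫ b`), then `b` maps
`im f` into itself:

* `AbelianVariety.imageRestrict f a b hab : image f ⟶ image f`, with
  `imageRestrict ≫ imageι f = imageι f ≫ b` (`imageRestrict_ι`) and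
  `toImage f ≫ imageRestrict = a ≫ toImage f` (`toImage_imageRestrict`); it is the identity on
  identities, multiplicative and additive (`imageRestrict_id`, `_comp`, `_add`);
* `AbelianVariety.imageAction` — for ring actions `φ : R →+* End X`, `ψ : R →+* End Y` making
  `f` equivariant, **the induced action `R →+* End (image f)`**, with `imageι f` and `toImage f`
  equivariant (`imageAction_ι`, `toImage_imageAction`).

Construction: the scheme morphism `im f ↪ Y → Y` lifts through the closed immersion `im f ↪ Y`
(Mathlib `IsClosedImmersion.lift`) because its composite with the schematically dominant
`X ↠ im f` does (`X → Y → Y` equals `X → X → im f ↪ Y`), exactly as the group law of `Y` was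
restricted to `im f` in `Motives/AbelianVarietyImage`; the group-homomorphism property is checked
after composing with the monomorphism `im f ↪ Y` (as for `kerComponentLift`,
`Motives/PrymVariety`). Application: with `Motives/AbelianVarietyPoincareSplitting`,
`…PoincareEquivariant(Polynomial)` and `…PoincarePerfectField`, the Poincaré complement
`Z = im (N • 𝟙 X - h̃ ≫ i)` of an abelian subvariety stable under a finite group or a CM order
carries the induced action, and `(i, j)`, `(h̃, t)` are equivariant — Poincaré's complete
reducibility theorem with operators (Lange–Rodríguez Thm. 2.7.1 for finite groups; Mumford §19
Thm. 1). Everything is proved; the `def`s are constructions with bodies (two of them private plumbing), no named fact (D-0026).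

## References

* D. Mumford, *Abelian Varieties* (1970), §19 Thm. 1 (p. 173: images of homomorphisms are
  abelian subvarieties) and proof of Cor. 2 (p. 174). [MumfordAV1970]
* H. Lange, R. E. Rodríguez, *Decomposition of Jacobians by Prym Varieties* (2022), §2.7,
  Thm. 2.7.1 and §2.9 (`G`-stable abelian subvarieties `A e_i = Im(…)`). [LangeRodriguez2022]
-/

noncomputable section

universe u

open CategoryTheory CategoryTheory.Limits AlgebraicGeometry MonoidalCategory CartesianMonoidalCategory

namespace Literature.AlgebraicGeometry.Motives

namespace AbelianVariety

open scoped MonObj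

variable {K : Type u} [Field K] {X Y : AbelianVariety K} (f : X ⟶ Y)
  (a : X ⟶ X) (b : Y ⟶ Y) (hab : a ≫ f = f ≫ b)

/-! ### The lift of `im f ↪ Y → Y` through `im f ↪ Y` -/

include hab in
/-- The compatibility `a ≫ f = f ≫ b` on the level of `K`-schemes, through the image:
`(X ↠ im f) ≫ (im f ↪ Y ≫ b) = (a ≫ X ↠ im f) ≫ (im f ↪ Y)`. [folklore] -/
private theorem toImageOver_comp_imageιOver_comp :
    toImageOver f ≫ (imageιOver f ≫ b.hom.hom.hom) = (a.hom.hom.hom ≫ toImageOver f) ≫ imageιOver f := by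
  rw [← Category.assoc, toImageOver_imageιOver, Category.assoc, toImageOver_imageιOver]
  exact congrArg (fun φ : X ⟶ Y ↦ φ.hom.hom.hom) hab.symm

include hab in
/-- The kernel of `im f ↪ Y` is contained in the kernel of `im f ↪ Y → Y` (`b` compatible with
`f`): checked after composing with the schematically dominant `X ↠ im f`. [folklore] -/
private theorem ker_imageι_le_ker_comp :
    (Hom.toSchemeHom f).imageι.ker ≤ (imageιOver f ≫ b.hom.hom.hom).left.ker := by
  have h2 : (toImageOver f).left ≫ (imageιOver f ≫ b.hom.hom.hom).left =
      (a.hom.hom.hom ≫ toImageOver f).left ≫ (imageιOver f).left := by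
    rw [← Over.comp_left, ← Over.comp_left, toImageOver_comp_imageιOver_comp f a b hab]
  have e : ((toImageOver f).left ≫ (imageιOver f ≫ b.hom.hom.hom).left).ker =
      (imageιOver f ≫ b.hom.hom.hom).left.ker := by
    rw [Scheme.Hom.ker_comp, IsSchemeTheoreticallyDominant.ker_eq_bot,
      Scheme.IdealSheafData.map_bot]
  rw [← e, h2]
  exact Scheme.Hom.le_ker_comp _ _

/-- The restriction of `b` to `im f`, on underlying schemes. [folklore] -/
private def imageRestrictLeft : (Hom.toSchemeHom f).image ⟶ (Hom.toSchemeHom f).image :=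
  IsClosedImmersion.lift (Hom.toSchemeHom f).imageι (imageιOver f ≫ b.hom.hom.hom).left
    (ker_imageι_le_ker_comp f a b hab)

/-- The restriction followed by `im f ↪ Y` is `im f ↪ Y → Y`, on schemes. [folklore] -/
@[reassoc (attr := simp)]
private theorem imageRestrictLeft_imageι :
    imageRestrictLeft f a b hab ≫ (Hom.toSchemeHom f).imageι = (imageιOver f ≫ b.hom.hom.hom).left :=
  IsClosedImmersion.lift_fac _ _ _

/-- The restriction of `b` to `im f`, as a `K`-morphism. [folklore] -/
private def imageRestrictOver : imageOver f ⟶ imageOver f :=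
  Over.homMk (imageRestrictLeft f a b hab) (by
    change imageRestrictLeft f a b hab ≫ (Hom.toSchemeHom f).imageι ≫ Y.X.hom = _
    rw [imageRestrictLeft_imageι_assoc]
    exact Over.w _)

/-- The restriction followed by `im f ↪ Y` is `im f ↪ Y ≫ b`, as `K`-morphisms. [folklore] -/
@[reassoc (attr := simp)]
private theorem imageRestrictOver_ι :
    imageRestrictOver f a b hab ≫ imageιOver f = imageιOver f ≫ b.hom.hom.hom := by
  ext1; exact imageRestrictLeft_imageι f a b hab

/-- The restriction respects units. [folklore] -/
private theorem one_imageRestrictOver :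
    η[(image f).X] ≫ imageRestrictOver f a b hab = η[(image f).X] := by
  change imageOne f ≫ imageRestrictOver f a b hab = imageOne f
  rw [← cancel_mono (imageιOver f), Category.assoc, imageRestrictOver_ι, ← Category.assoc,
    imageOne_imageιOver, IsMonHom.one_hom]

/-- The restriction respects multiplication. [folklore] -/
private theorem mul_imageRestrictOver :
    μ[(image f).X] ≫ imageRestrictOver f a b hab =
      (imageRestrictOver f a b hab ⊗ₘ imageRestrictOver f a b hab) ≫ μ[(image f).X] := by
  change imageMul f ≫ imageRestrictOver f a b hab =
    (imageRestrictOver f a b hab ⊗ₘ imageRestrictOver f a b hab) ≫ imageMul f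
  have hl : (imageMul f ≫ imageRestrictOver f a b hab) ≫ imageιOver f =
      ((imageιOver f ≫ b.hom.hom.hom) ⊗ₘ (imageιOver f ≫ b.hom.hom.hom)) ≫ μ[Y.X] := by
    rw [Category.assoc, imageRestrictOver_ι, ← Category.assoc, imageMul_imageιOver, Category.assoc,
      IsMonHom.mul_hom, ← Category.assoc, tensorHom_comp_tensorHom]
  have hr : ((imageRestrictOver f a b hab ⊗ₘ imageRestrictOver f a b hab) ≫ imageMul f) ≫
      imageιOver f = ((imageιOver f ≫ b.hom.hom.hom) ⊗ₘ (imageιOver f ≫ b.hom.hom.hom)) ≫ μ[Y.X] := by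
    rw [Category.assoc, imageMul_imageιOver, ← Category.assoc, tensorHom_comp_tensorHom,
      imageRestrictOver_ι]
  rw [← cancel_mono (imageιOver f), hl, hr]

/-- **Endomorphisms compatible with `f` restrict to the image**: for `a ≫ f = f ≫ b`, the
endomorphism of the abelian variety `im f` induced by `b`. [cite: MumfordAV1970, §19 Thm. 1 (p. 173)] -/
def imageRestrict : image f ⟶ image f :=
  InducedCategory.homMk (Grp.homMk'' (A := (image f).toGrp) (B := (image f).toGrp)
    (imageRestrictOver f a b hab) (one_imageRestrictOver f a b hab) (mul_imageRestrictOver f a b hab))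

/-- The restriction is compatible with the inclusion: `imageRestrict ≫ imageι f = imageι f ≫ b`.
[cite: MumfordAV1970, §19 Thm. 1 (p. 173)] -/
@[reassoc (attr := simp)]
theorem imageRestrict_ι : imageRestrict f a b hab ≫ imageι f = imageι f ≫ b :=
  AbelianVariety.hom_ext _ _ (imageRestrictOver_ι f a b hab)

/-- The restriction is compatible with the projection: `toImage f ≫ imageRestrict = a ≫ toImage f`.
[cite: MumfordAV1970, §19 Thm. 1 (p. 173)] -/
@[reassoc]
theorem toImage_imageRestrict : toImage f ≫ imageRestrict f a b hab = a ≫ toImage f := by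
  haveI := mono_of_isClosedImmersion_toSchemeHom (imageι f)
  rw [← cancel_mono (imageι f), Category.assoc, imageRestrict_ι, toImage_imageι_assoc,
    Category.assoc, toImage_imageι, hab]

/-- The restriction is the unique endomorphism of `im f` compatible with the inclusion
(`im f ↪ Y` is a monomorphism). [cite: MumfordAV1970, §19 Thm. 1 (p. 173)] -/
theorem imageRestrict_unique (r : image f ⟶ image f) (hr : r ≫ imageι f = imageι f ≫ b) :
    r = imageRestrict f a b hab := by
  haveI := mono_of_isClosedImmersion_toSchemeHom (imageι f)
  rw [← cancel_mono (imageι f), hr, imageRestrict_ι]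

/-- Restriction of the identities is the identity (functoriality of restricting compatible
endomorphisms to the abelian subvariety `im f`). [cite: MumfordAV1970, §19 Thm. 1 (p. 173)] -/
@[simp]
theorem imageRestrict_id :
    imageRestrict f (𝟙 X) (𝟙 Y) (by rw [Category.id_comp, Category.comp_id]) = 𝟙 _ := by
  haveI := mono_of_isClosedImmersion_toSchemeHom (imageι f)
  rw [← cancel_mono (imageι f), imageRestrict_ι, Category.id_comp, Category.comp_id]

/-- Restriction is multiplicative (functoriality of restricting compatible endomorphisms to the
abelian subvariety `im f`). [cite: MumfordAV1970, §19 Thm. 1 (p. 173)] -/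
theorem imageRestrict_comp (a a' : X ⟶ X) (b b' : Y ⟶ Y) (hab : a ≫ f = f ≫ b)
    (hab' : a' ≫ f = f ≫ b') :
    imageRestrict f (a ≫ a') (b ≫ b')
        (by rw [Category.assoc, hab', ← Category.assoc, hab, Category.assoc]) =
      imageRestrict f a b hab ≫ imageRestrict f a' b' hab' := by
  haveI := mono_of_isClosedImmersion_toSchemeHom (imageι f)
  rw [← cancel_mono (imageι f), imageRestrict_ι, Category.assoc, imageRestrict_ι,
    imageRestrict_ι_assoc]

/-- Restriction is additive (restriction to the abelian subvariety `im f` is a map of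
`Hom`-groups). [cite: MumfordAV1970, §19 Thm. 1 (p. 173)] -/
theorem imageRestrict_add (a a' : X ⟶ X) (b b' : Y ⟶ Y) (hab : a ≫ f = f ≫ b)
    (hab' : a' ≫ f = f ≫ b') :
    imageRestrict f (a + a') (b + b') (by rw [Preadditive.add_comp, Preadditive.comp_add, hab, hab']) =
      imageRestrict f a b hab + imageRestrict f a' b' hab' := by
  haveI := mono_of_isClosedImmersion_toSchemeHom (imageι f)
  rw [← cancel_mono (imageι f), imageRestrict_ι, Preadditive.add_comp, imageRestrict_ι,
    imageRestrict_ι, Preadditive.comp_add]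

/-! ### Induced ring actions on the image -/

section Action

variable {R : Type*} [Semiring R] (φ : R →+* End X) (ψ : R →+* End Y)
  (hf : ∀ r : R, End.asHom (φ r) ≫ f = f ≫ End.asHom (ψ r))

/-- **The induced action on the image**: for ring actions `φ : R →+* End X`, `ψ : R →+* End Y`
making `f` equivariant, the action `R →+* End (im f)` by restriction of `ψ`.
[cite: LangeRodriguez2022, Thm. 2.7.1] [cite: MumfordAV1970, §19 Thm. 1 (p. 173)] -/
def imageAction : R →+* End (image f) where
  toFun r := imageRestrict f (End.asHom (φ r)) (End.asHom (ψ r)) (hf r)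
  map_one' := by
    have e : imageRestrict f (End.asHom (φ 1)) (End.asHom (ψ 1)) (hf 1) =
        imageRestrict f (𝟙 X) (𝟙 Y) (by rw [Category.id_comp, Category.comp_id]) := by
      congr 1 <;> rw [map_one] <;> rfl
    exact e.trans (imageRestrict_id f)
  map_mul' r s := by
    have e : imageRestrict f (End.asHom (φ (r * s))) (End.asHom (ψ (r * s))) (hf (r * s)) =
        imageRestrict f (End.asHom (φ s) ≫ End.asHom (φ r)) (End.asHom (ψ s) ≫ End.asHom (ψ r))
          (by rw [Category.assoc, hf r, ← Category.assoc, hf s, Category.assoc]) := by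
      congr 1 <;> rw [map_mul] <;> rfl
    exact e.trans (imageRestrict_comp f _ _ _ _ (hf s) (hf r))
  map_zero' := by
    haveI := mono_of_isClosedImmersion_toSchemeHom (imageι f)
    change imageRestrict f (End.asHom (φ 0)) (End.asHom (ψ 0)) (hf 0) = 0
    rw [← cancel_mono (imageι f), imageRestrict_ι, map_zero, zero_comp]
    exact comp_zero
  map_add' r s := by
    have e : imageRestrict f (End.asHom (φ (r + s))) (End.asHom (ψ (r + s))) (hf (r + s)) =
        imageRestrict f (End.asHom (φ r) + End.asHom (φ s)) (End.asHom (ψ r) + End.asHom (ψ s))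
          (by rw [Preadditive.add_comp, Preadditive.comp_add, hf r, hf s]) := by
      congr 1 <;> rw [map_add] <;> rfl
    exact e.trans (imageRestrict_add f _ _ _ _ (hf r) (hf s))

/-- The inclusion `im f ↪ Y` is equivariant for the induced action. [cite: LangeRodriguez2022, Thm. 2.7.1] -/
theorem imageAction_ι (r : R) :
    End.asHom (imageAction f φ ψ hf r) ≫ imageι f = imageι f ≫ End.asHom (ψ r) :=
  imageRestrict_ι f _ _ (hf r)

/-- The projection `X ↠ im f` is equivariant for the induced action. [cite: LangeRodriguez2022, Thm. 2.7.1] -/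
theorem toImage_imageAction (r : R) :
    toImage f ≫ End.asHom (imageAction f φ ψ hf r) = End.asHom (φ r) ≫ toImage f :=
  toImage_imageRestrict f _ _ (hf r)

end Action

end AbelianVariety

end Literature.AlgebraicGeometry.Motives
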